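import Mathlib.MeasureTheory.Measure.SeparableMeasure
import Mathlib.Topology.MetricSpace.Polish
import Literature.Analysis.FluidPDE.StatisticalSolutions
import Literature.Analysis.FluidPDE.TimeAverageMeasureBasic
import Literature.Analysis.FluidPDE.EnergySpaceRellich
import Literature.Analysis.FluidPDE.LerayHopfUniformEnergy
import Literature.Analysis.FunctionSpaces.HilbertValuedMeasurability
import Literature.MeasureTheory.RieszRepresentation.TightFunctional
import HarnessLib

/-!
# Existence of time-average measures of Leray–Hopf solutions on `T³`

Discharge of the named fact `Literature.Analysis.FluidPDE.exists_timeAverageMeasure`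
(`StatisticalSolutions`, item **turb.S07**; Foias–Manley–Rosa–Temam 2001, Ch. IV §1.3 Def. 1.3,
(1.28), and §3.1 Prop. 3.1, PDF pp. 208–210): for a global Leray–Hopf weak solution `u` of the
space-periodic Navier–Stokes equations with viscosity `ν > 0` and steady force `f ∈ H`, lifted to
the energy space `U : [0, ∞) → H`, and a generalized (Banach) limit `Λ`, there is a Borel
probability measure `μ` on `H` with

  `∫ Ψ dμ = Lim_{T → ∞} T⁻¹ ∫₀ᵀ Ψ(U t) dt`  for every bounded norm-continuous `Ψ : H → ℝ`.

## Proof (library chain)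

The right-hand side is a positive linear functional `L` on `C_b(H)` with `L 1 = 1`
(`Torus.exists_linearMap_longTimeAvg`; linearity needs the measurability of `t ↦ Ψ(U t)`, which
comes from the joint measurability clause of the weak formulation through the `L²`-slice form of
Pettis' theorem, `FunctionSpaces.aestronglyMeasurable_of_ae_eq_slice`, and the embedding
`H ⊂ L²`: `Torus.IsGlobalLerayHopf.aestronglyMeasurable_lift`). It is **tight**
(`Torus.IsGlobalLerayHopf.exists_isCompact_abs_longTimeAvg_le`): the enstrophy balls
`K_R = {v ∈ H | ‖∇v‖₂² ≤ R}` are compact in `H` (Rellich, `Torus.isCompact_setOf_eGradNormSq_le`)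
and, by Chebyshev in time and the a priori bound `ν ∫₀ᵀ ‖∇u‖₂² ≤ |u₀|² + (|f|²/ν) T`
(FMRT (3.4), `Torus.IsGlobalLerayHopf.toReal_lintegral_eGradNormSq_le`), the fraction of time
spent outside `K_R` is `O(1/R)` uniformly in `T ≥ 1`, so `|L Ψ| ≤ ε ‖Ψ‖` for `Ψ` vanishing on
`K_R`, `R = R(ε)`. Since `H` is Polish (a closed subspace of the separable Hilbert space
`L²(T³; ℝ³)`, Mathlib's `Lp.SecondCountableTopology`), the representation theorem for tight
functionals (`RieszRepresentation.exists_probabilityMeasure_of_isTightFunctional`,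
Berg–Christensen–Ressel 1984, Ch. 2 Thm. 2.2) gives `μ`. In the printed proof (FMRT p. 209) the
measure is produced on a weakly compact ball by the Riesz–Kakutani theorem for the weakly
continuous observables; the norm-continuous class used by `Torus.IsTimeAverageMeasure` needs the
tightness in the norm topology supplied here by Rellich.

## Mathlib / tree search

Used from the tree: `RieszRepresentation.exists_probabilityMeasure_of_isTightFunctional`,
`Torus.isCompact_setOf_eGradNormSq_le`, `Torus.IsGlobalLerayHopf.toReal_lintegral_eGradNormSq_le`,
`Torus.eGradNormSq_coe_lift`, `Torus.IsLerayHopfOn.aestronglyMeasurable_uncurry`,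
`…aemeasurable_eGradNormSq`, `…lintegral_eGradNormSq_lt_top`, `Torus.Ioi_zero_eq_iUnion_Ioo_nat`,
`FunctionSpaces.aestronglyMeasurable_of_ae_eq_slice`, the `GeneralizedLimit` calculus of
`TimeAverageMeasureBasic`; from Mathlib `Lp.SecondCountableTopology`, `PolishSpace`,
`IsEmbedding.aestronglyMeasurable_comp_iff`, `IntegrableOn.of_bound`, `integral_toReal`,
`norm_integral_le_of_norm_le`. No statement of the existence of time-average measures exists in
the tree (searched `exists_timeAverageMeasure`, `IsTimeAverageMeasure`: statement files and
`TimeAverageMeasureBasic` only).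

## References

* C. Foias, O. Manley, R. Rosa, R. Temam, *Navier–Stokes Equations and Turbulence*, Cambridge
  Univ. Press (2001), Ch. IV §1.3 Def. 1.3, (1.28); §3.1 Prop. 3.1, (3.2)–(3.4), PDF pp. 208–210.
  [FMRT2001]
* C. Berg, J. P. R. Christensen, P. Ressel, *Harmonic Analysis on Semigroups*, GTM 100,
  Springer 1984, Ch. 2 §2 Thm. 2.2. [BergChristensenRessel1984]
-/

noncomputable section

open MeasureTheory Filter Set Function TopologicalSpace
open scoped ENNReal NNReal Topology BoundedContinuousFunction

namespace Literature.Analysis.FluidPDE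

/-! ### Calculus of generalized long-time averages -/

namespace GeneralizedLimit

variable (Λ : GeneralizedLimit)

/-- **Additivity** of the generalized long-time average on functions that are integrable on every
`(0, T]`: the Cesàro means are additive there, and `Lim` is linear and only sees the germ at
`+∞` (FMRT 2001, Ch. IV §1.3 Def. 1.4 (i)). [cite: FMRT2001, Ch. IV §1.3 Def. 1.4] -/
theorem longTimeAvg_add {g h : ℝ → ℝ} (hg : ∀ T, 0 < T → IntervalIntegrable g volume 0 T)
    (hh : ∀ T, 0 < T → IntervalIntegrable h volume 0 T) :
    Λ.longTimeAvg (fun t => g t + h t) = Λ.longTimeAvg g + Λ.longTimeAvg h := by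
  unfold GeneralizedLimit.longTimeAvg
  rw [← map_add]
  refine Λ.apply_eq_of_eventuallyEq ?_
  filter_upwards [eventually_gt_atTop 0] with T hT
  simp only [timeMean, Pi.add_apply]
  rw [intervalIntegral.integral_add (hg T hT) (hh T hT), mul_add]

/-- **Homogeneity** of the generalized long-time average (no integrability needed:
`∫ c g = c ∫ g` holds for the Bochner integral unconditionally; FMRT 2001, Ch. IV §1.3
Def. 1.4 (i)). [cite: FMRT2001, Ch. IV §1.3 Def. 1.4] -/
theorem longTimeAvg_const_mul (c : ℝ) (g : ℝ → ℝ) :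
    Λ.longTimeAvg (fun t => c * g t) = c * Λ.longTimeAvg g := by
  unfold GeneralizedLimit.longTimeAvg
  have h : timeMean (fun t => c * g t) = c • timeMean g := by
    funext T
    simp only [timeMean, Pi.smul_apply, smul_eq_mul]
    rw [intervalIntegral.integral_const_mul]
    ring
  rw [h, map_smul, smul_eq_mul]

/-- **Positivity** of the generalized long-time average: a nonnegative function bounded on
`(0, ∞)` has `⟨g⟩_Λ ≥ 0` (FMRT 2001, Ch. IV (1.35)). [cite: FMRT2001, Ch. IV §1.3 (1.35)] -/
theorem longTimeAvg_nonneg {g : ℝ → ℝ} (h0 : ∀ t, 0 ≤ g t) {C : ℝ}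
    (hC : ∀ t, 0 < t → |g t| ≤ C) : 0 ≤ Λ.longTimeAvg g := by
  unfold GeneralizedLimit.longTimeAvg
  refine Λ.apply_nonneg (isBoundedUnder_le_timeMean hC) ?_
  filter_upwards [eventually_gt_atTop 0] with T hT
  unfold timeMean
  exact mul_nonneg (inv_nonneg.2 hT.le)
    (intervalIntegral.integral_nonneg hT.le fun t _ => h0 t)

/-- The generalized long-time average of the constant `1` is `1` (the Cesàro means are
identically `1` for `T ≠ 0`; FMRT 2001, Ch. IV (1.36)). [cite: FMRT2001, Ch. IV §1.3 (1.36)] -/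
theorem longTimeAvg_one : Λ.longTimeAvg (fun _ => (1 : ℝ)) = 1 := by
  unfold GeneralizedLimit.longTimeAvg
  have h : timeMean (fun _ => (1 : ℝ)) =ᶠ[atTop] fun _ => 1 := by
    filter_upwards [eventually_gt_atTop 0] with T hT
    simp only [timeMean, intervalIntegral.integral_const, sub_zero, smul_eq_mul, mul_one]
    exact inv_mul_cancel₀ hT.ne'
  rw [Λ.apply_eq_of_eventuallyEq h, Λ.apply_const]

end GeneralizedLimit

namespace Torus

variable {d : Type*} [Fintype d] [DecidableEq d]

/-! ### Measurability of the lifted trajectory -/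

section Lift

variable {ν : ℝ} {f : ℝ → UnitAddTorus d → EuclideanSpace ℝ d}
  {u₀ : UnitAddTorus d → EuclideanSpace ℝ d} {u : ℝ → UnitAddTorus d → EuclideanSpace ℝ d}
  {U : ℝ → FunctionSpaces.Torus.energySpace d}

/-- **The `H`-lift of a Leray–Hopf trajectory is a.e. strongly measurable on `(0, ∞)`.** The
weak formulation records the joint measurability of `(t, x) ↦ u t x` on `(0,T) × T^d`; the
`L²` classes of the slices of a jointly measurable function form an a.e. strongly measurable
`L²`-valued map (Pettis in the separable Hilbert space `L²`, through Fubini: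
`FunctionSpaces.aestronglyMeasurable_of_ae_eq_slice`), and `H ⊂ L²` is an embedding
(Temam 1984, Ch. III §1.1: measurability in time of `V`/`H`-valued weak solutions). [folklore] -/
theorem IsGlobalLerayHopf.aestronglyMeasurable_lift (hu : IsGlobalLerayHopf ν f u₀ u)
    (hU : ∀ t, 0 ≤ t →
      (((U t : Lp (EuclideanSpace ℝ d) 2 (volume : Measure (UnitAddTorus d))) :
        UnitAddTorus d → EuclideanSpace ℝ d)) =ᵐ[volume] u t) :
    AEStronglyMeasurable U (volume.restrict (Ioi 0)) := by
  rw [Ioi_zero_eq_iUnion_Ioo_nat, aestronglyMeasurable_iUnion_iff]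
  intro n
  rcases Nat.eq_zero_or_pos n with hn | hn
  · subst hn
    simp
  have hLH := hu n (by exact_mod_cast hn)
  have h1 : AEStronglyMeasurable
      (fun t => (U t : Lp (EuclideanSpace ℝ d) 2 (volume : Measure (UnitAddTorus d))))
      (volume.restrict (Ioo 0 (n : ℝ))) := by
    refine FunctionSpaces.aestronglyMeasurable_of_ae_eq_slice (G := uncurry u)
      hLH.aestronglyMeasurable_uncurry ?_
    filter_upwards [ae_restrict_mem measurableSet_Ioo] with t ht
    exact hU t ht.1.le
  exact (Topology.IsEmbedding.subtypeVal.aestronglyMeasurable_comp_iff).1 h1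

/-- Along an a.e. strongly measurable trajectory `U : (0, ∞) → H`, every bounded continuous
observable `g` gives a function `t ↦ g (U t)` which is integrable on each `(0, T]` (bounded by
`‖g‖`, measurable as a continuous image). [folklore] -/
theorem intervalIntegrable_comp_lift (hUm : AEStronglyMeasurable U (volume.restrict (Ioi 0)))
    (g : FunctionSpaces.Torus.energySpace d →ᵇ ℝ) {T : ℝ} (hT : 0 < T) :
    IntervalIntegrable (fun t => g (U t)) volume 0 T := by
  rw [intervalIntegrable_iff_integrableOn_Ioc_of_le hT.le]
  have hm : AEStronglyMeasurable (fun t => g (U t)) (volume.restrict (Ioc 0 T)) :=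
    (g.continuous.comp_aestronglyMeasurable hUm).mono_measure
      (Measure.restrict_mono Ioc_subset_Ioi_self le_rfl)
  exact IntegrableOn.of_bound measure_Ioc_lt_top hm ‖g‖
    (ae_of_all _ fun t => g.norm_coe_le_norm (U t))

end Lift

/-! ### The time-average functional on `C_b(H)` -/

/-- **The generalized time average as a linear functional on `C_b(H)`.** For an a.e. strongly
measurable trajectory `U : (0, ∞) → H` and a generalized limit `Λ`, the map
`g ↦ Lim_{T → ∞} T⁻¹ ∫₀ᵀ g(U t) dt` is an `ℝ`-linear functional on the bounded continuous
functions (FMRT 2001, Ch. IV §3.1, (3.1) and the display before Prop. 3.1, p. 208: "a positive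
linear functional"). [cite: FMRT2001, Ch. IV §3.1 (3.1)] -/
theorem exists_linearMap_longTimeAvg (Λ : GeneralizedLimit)
    {U : ℝ → FunctionSpaces.Torus.energySpace d}
    (hUm : AEStronglyMeasurable U (volume.restrict (Ioi 0))) :
    ∃ L : (FunctionSpaces.Torus.energySpace d →ᵇ ℝ) →ₗ[ℝ] ℝ,
      ∀ g : FunctionSpaces.Torus.energySpace d →ᵇ ℝ, L g = Λ.longTimeAvg (fun t => g (U t)) := by
  refine ⟨{ toFun := fun g => Λ.longTimeAvg (fun t => g (U t))
            map_add' := fun g₁ g₂ => ?_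
            map_smul' := fun c g => ?_ }, fun g => rfl⟩
  · simp only [BoundedContinuousFunction.coe_add, Pi.add_apply]
    exact Λ.longTimeAvg_add (fun T hT => intervalIntegrable_comp_lift hUm g₁ hT)
      (fun T hT => intervalIntegrable_comp_lift hUm g₂ hT)
  · simp only [BoundedContinuousFunction.coe_smul, smul_eq_mul, RingHom.id_apply]
    exact Λ.longTimeAvg_const_mul c _

/-! ### Tightness of the time averages of a Leray–Hopf trajectory -/

section Tight

variable {ν : ℝ} {F u₀ : UnitAddTorus d → EuclideanSpace ℝ d}
  {u : ℝ → UnitAddTorus d → EuclideanSpace ℝ d} {U : ℝ → FunctionSpaces.Torus.energySpace d}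

/-- **Tightness of the time averages in the norm topology of `H`** (FMRT 2001, Ch. IV §3.1,
(3.2)–(3.4), p. 209, upgraded from the weak to the norm topology by Rellich). Let `u` be a
global Leray–Hopf solution on `T^d` with `ν > 0` and steady force `F ∈ L²`, lifted to
`U : [0, ∞) → H`, and let `Λ` be a generalized limit. For every `ε > 0` there is a compact
`K ⊆ H` — an enstrophy ball `{‖∇v‖₂² ≤ R}` (`Torus.isCompact_setOf_eGradNormSq_le`) — such that
`|Lim T⁻¹ ∫₀ᵀ g(U t) dt| ≤ ε ‖g‖` for every bounded continuous `g` vanishing on `K`: outside `K`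
one has `1 < ‖∇u(t)‖₂² / R`, so `T⁻¹ ∫₀ᵀ |g(U t)| dt ≤ ‖g‖ (RT)⁻¹ ∫₀ᵀ ‖∇u‖₂²`, and
`ν ∫₀ᵀ ‖∇u‖₂² ≤ |u₀|² + (|F|²/ν) T` (`toReal_lintegral_eGradNormSq_le`). [cite: FMRT2001, Ch. IV §3.1 (3.2)–(3.4)] -/
theorem IsGlobalLerayHopf.exists_isCompact_abs_longTimeAvg_le (hν : 0 < ν) (hF : MemLp F 2 volume)
    (hu : IsGlobalLerayHopf ν (fun _ => F) u₀ u)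
    (hU : ∀ t, 0 ≤ t →
      (((U t : Lp (EuclideanSpace ℝ d) 2 (volume : Measure (UnitAddTorus d))) :
        UnitAddTorus d → EuclideanSpace ℝ d)) =ᵐ[volume] u t)
    (Λ : GeneralizedLimit) {ε : ℝ} (hε : 0 < ε) :
    ∃ K : Set (FunctionSpaces.Torus.energySpace d), IsCompact K ∧
      ∀ g : FunctionSpaces.Torus.energySpace d →ᵇ ℝ, (∀ v ∈ K, g v = 0) →
        |Λ.longTimeAvg (fun t => g (U t))| ≤ ε * ‖g‖ := by
  -- the constants of the a priori bound `ν ∫₀ᵀ ‖∇u‖² ≤ A + B T`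
  set A : ℝ := 2 * FunctionSpaces.Torus.kineticEnergy u₀ with hA
  set B : ℝ := (∫ x, ‖F x‖ ^ 2) / ν with hB
  have hA0 : 0 ≤ A := mul_nonneg zero_le_two (FunctionSpaces.Torus.kineticEnergy_nonneg _)
  have hB0 : 0 ≤ B := div_nonneg (integral_nonneg fun x => sq_nonneg _) hν.le
  set M : ℝ := (A + B) / ν + 1 with hM
  have hM0 : 0 < M := by positivity
  set R : ℝ≥0∞ := ENNReal.ofReal (M / ε) with hR
  set K : Set (FunctionSpaces.Torus.energySpace d) := {v | FunctionSpaces.Torus.eGradNormSq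
    ((v : Lp (EuclideanSpace ℝ d) 2 (volume : Measure (UnitAddTorus d))) :
      UnitAddTorus d → EuclideanSpace ℝ d) ≤ R} with hK
  refine ⟨K, isCompact_setOf_eGradNormSq_le ENNReal.ofReal_ne_top, fun g hg => ?_⟩
  set c : ℝ := ‖g‖ * (ε / M) with hc
  have hc0 : 0 ≤ c := mul_nonneg (norm_nonneg _) (div_nonneg hε.le hM0.le)
  -- eventual bound on the Cesàro means
  refine Λ.abs_apply_le ?_
  filter_upwards [eventually_ge_atTop 1] with T hT
  have hT0 : 0 < T := one_pos.trans_le hT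
  have hLH := hu T hT0
  -- measurability / finiteness of the enstrophy on `(0, T]`
  have hIoc : (volume.restrict (Ioo 0 T) : Measure ℝ) = volume.restrict (Ioc 0 T) :=
    Measure.restrict_congr_set Ioo_ae_eq_Ioc
  have hmeas : AEMeasurable (fun t => FunctionSpaces.Torus.eGradNormSq (u t))
      (volume.restrict (Ioc 0 T)) := hIoc ▸ hLH.aemeasurable_eGradNormSq
  have hfin : ∫⁻ t in Ioc 0 T, FunctionSpaces.Torus.eGradNormSq (u t) < ∞ := by
    rw [← hIoc]
    exact hLH.lintegral_eGradNormSq_lt_top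
  have hlt : ∀ᵐ t ∂(volume.restrict (Ioc 0 T)), FunctionSpaces.Torus.eGradNormSq (u t) < ∞ :=
    ae_lt_top' hmeas hfin.ne
  -- pointwise: `|g (U t)| ≤ c ‖∇u(t)‖₂²` for a.e. `t ∈ (0, T]`
  have hpt : ∀ᵐ t ∂(volume.restrict (Ioc 0 T)),
      ‖g (U t)‖ ≤ c * (FunctionSpaces.Torus.eGradNormSq (u t)).toReal := by
    filter_upwards [hlt, ae_restrict_mem measurableSet_Ioc] with t ht htm
    by_cases hUt : U t ∈ K
    · rw [hg _ hUt, norm_zero]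
      exact mul_nonneg hc0 ENNReal.toReal_nonneg
    · have hgt : R < FunctionSpaces.Torus.eGradNormSq (u t) := by
        rw [← eGradNormSq_coe_lift hU htm.1.le]
        exact not_le.1 hUt
      have hMε : M / ε < (FunctionSpaces.Torus.eGradNormSq (u t)).toReal :=
        (ENNReal.ofReal_lt_iff_lt_toReal (div_nonneg hM0.le hε.le) ht.ne).1 hgt
      have h1 : 1 ≤ ε / M * (FunctionSpaces.Torus.eGradNormSq (u t)).toReal := by
        have h := (div_lt_iff₀ hε).1 hMε
        rw [div_mul_eq_mul_div, le_div_iff₀ hM0]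
        linarith
      calc ‖g (U t)‖ ≤ ‖g‖ := g.norm_coe_le_norm (U t)
        _ = ‖g‖ * 1 := (mul_one _).symm
        _ ≤ ‖g‖ * (ε / M * (FunctionSpaces.Torus.eGradNormSq (u t)).toReal) := by
            gcongr
        _ = c * (FunctionSpaces.Torus.eGradNormSq (u t)).toReal := by rw [hc, mul_assoc]
  -- integrate: `∫₀ᵀ |g (U t)| ≤ c ∫₀ᵀ ‖∇u‖₂² ≤ c (A + B T) / ν`
  set D : ℝ := (∫⁻ t in Ioo 0 T, FunctionSpaces.Torus.eGradNormSq (u t)).toReal with hD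
  have hD0 : 0 ≤ D := ENNReal.toReal_nonneg
  have hDle : ν * D ≤ A + B * T := hu.toReal_lintegral_eGradNormSq_le hν hF hU hT0.le
  have hint : ‖∫ t in Ioc 0 T, g (U t)‖ ≤ c * D := by
    have hgi : Integrable (fun t => c * (FunctionSpaces.Torus.eGradNormSq (u t)).toReal)
        (volume.restrict (Ioc 0 T)) :=
      (integrable_toReal_of_lintegral_ne_top hmeas hfin.ne).const_mul c
    calc ‖∫ t in Ioc 0 T, g (U t)‖
        ≤ ∫ t in Ioc 0 T, c * (FunctionSpaces.Torus.eGradNormSq (u t)).toReal :=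
          norm_integral_le_of_norm_le hgi hpt
      _ = c * D := by
          rw [integral_const_mul, integral_toReal hmeas hlt, hD, hIoc]
  -- conclude
  have hmean : |timeMean (fun t => g (U t)) T| ≤ T⁻¹ * (c * D) := by
    unfold timeMean
    rw [intervalIntegral.integral_of_le hT0.le, abs_mul, abs_inv, abs_of_pos hT0]
    gcongr
    rw [← Real.norm_eq_abs]
    exact hint
  refine hmean.trans ?_
  rw [inv_mul_le_iff₀ hT0, hc]
  -- `‖g‖ (ε / M) D ≤ T ε ‖g‖` since `D ≤ M T`
  have hDM : D ≤ M * T := by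
    have h1 : A + B * T ≤ ν * M * T := by
      have hAT : A ≤ A * T := le_mul_of_one_le_right hA0 hT
      have hexp : ν * M * T = (A + B) * T + ν * T := by
        rw [hM]
        field_simp
      nlinarith [mul_pos hν hT0]
    have h2 : ν * D ≤ ν * (M * T) := by nlinarith
    exact le_of_mul_le_mul_left h2 hν
  have hg0 : 0 ≤ ‖g‖ := norm_nonneg g
  calc ‖g‖ * (ε / M) * D ≤ ‖g‖ * (ε / M) * (M * T) := by gcongr
    _ = T * (ε * ‖g‖) := by field_simp

end Tight

end Torus

/-! ### The discharge -/

/-- Discharge of the named fact `exists_timeAverageMeasure` (**turb.S07**; FMRT 2001, Ch. IV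
§1.3 Def. 1.3, (1.28), and §3.1 Prop. 3.1, PDF pp. 208–210): **time-average measures of a
global Leray–Hopf solution exist** for every generalized limit. The generalized time average
`Ψ ↦ Lim T⁻¹ ∫₀ᵀ Ψ(U t) dt` is a positive, normalised linear functional on `C_b(H)`
(`Torus.exists_linearMap_longTimeAvg`), tight in the norm topology of `H` by the enstrophy bound
(3.4) and Rellich (`Torus.IsGlobalLerayHopf.exists_isCompact_abs_longTimeAvg_le`); `H` being
Polish, it is the expectation of a Borel probability measure on `H`
(`RieszRepresentation.exists_probabilityMeasure_of_isTightFunctional`, Berg–Christensen–Ressel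
1984, Ch. 2 Thm. 2.2), which is the asserted time-average measure. [cite: FMRT2001, Ch. IV §3.1 Prop. 3.1; §1.3 Def. 1.3 (1.28)] -/
theorem exists_timeAverageMeasure_holds : exists_timeAverageMeasure := by
  intro ν hν f u₀ u hu U hU Λ
  classical
  haveI : Fact ((2 : ℝ≥0∞) ≠ ∞) := ⟨ENNReal.ofNat_ne_top⟩
  haveI : SecondCountableTopology
      (Lp (EuclideanSpace ℝ (Fin 3)) 2 (volume : Measure (UnitAddTorus (Fin 3)))) :=
    inferInstance
  haveI : SecondCountableTopology (FunctionSpaces.Torus.energySpace (Fin 3)) :=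
    TopologicalSpace.Subtype.secondCountableTopology _
  haveI : PolishSpace (FunctionSpaces.Torus.energySpace (Fin 3)) := inferInstance
  -- measurability of the lift and the functional
  have hUm : AEStronglyMeasurable U (volume.restrict (Ioi 0)) :=
    Torus.IsGlobalLerayHopf.aestronglyMeasurable_lift hu hU
  obtain ⟨L, hL⟩ := Torus.exists_linearMap_longTimeAvg Λ hUm
  have hpos : ∀ g : FunctionSpaces.Torus.energySpace (Fin 3) →ᵇ ℝ, (∀ x, 0 ≤ g x) → 0 ≤ L g := by
    intro g hg
    rw [hL]
    exact Λ.longTimeAvg_nonneg (fun t => hg (U t)) (C := ‖g‖) fun t _ => by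
      rw [← Real.norm_eq_abs]
      exact g.norm_coe_le_norm (U t)
  have hone : L 1 = 1 := by
    rw [hL]
    exact Λ.longTimeAvg_one
  have htight : Literature.MeasureTheory.RieszRepresentation.IsTightFunctional L := by
    intro ε hε
    obtain ⟨K, hK, hKε⟩ :=
      Torus.IsGlobalLerayHopf.exists_isCompact_abs_longTimeAvg_le hν (Lp.memLp _) hu hU Λ hε
    exact ⟨K, hK, fun g hg => by rw [hL]; exact hKε g hg⟩
  obtain ⟨μ, hμ, hint⟩ :=
    Literature.MeasureTheory.RieszRepresentation.exists_probabilityMeasure_of_isTightFunctional L hpos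
      htight hone
  refine ⟨μ, hμ, fun Ψ hΨc hΨb => ?_⟩
  obtain ⟨C, hC⟩ := hΨb.exists_norm_le
  set g : FunctionSpaces.Torus.energySpace (Fin 3) →ᵇ ℝ :=
    BoundedContinuousFunction.ofNormedAddCommGroup Ψ hΨc C fun x => hC _ ⟨x, rfl⟩ with hg
  have h := hint g
  rw [hL] at h
  simpa only [hg, BoundedContinuousFunction.coe_ofNormedAddCommGroup] using h

end Literature.Analysis.FluidPDE
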